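import Literature.NumberTheory.Automorphic.TunnellCubicLiftsOfLemma
import HarnessLib

/-!
# The quadratic field cut out by an open subgroup of index two, and its Frobenius dictionary

Helper file for the item `EssSelfDualIrreducibleCM` (stmt-Langlands-13618) of the route
`IrreducibilityBySelfDuality`.  For a number field `K` and an OPEN subgroup `H ≤ Γ_K` of index `2`
there is a quadratic extension `L/K` (the fixed field `K̄^H`) such that at almost every finite place
`v` of `K`, for every arithmetic Frobenius `Φ` at every prime above `v`:
`Φ ∈ H ↔` some place of `L` above `v` has residue degree `1` (i.e. `v` splits in `L`) — the
Galois-theoretic half of the dictionary "quadratic characters of `Γ_K` ↔ quadratic extensions ↔ the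
sign `ε_{L/K}(v)`" (Neukirch I (9.3)–(9.5); Cassels–Fröhlich VII §4.2).  The proof is the one of the
tree's `exists_artinChar_frob_eq_quadraticSign` (`TunnellCubicLiftsOfLemma`), run for the fixed field
of `H` (`ArtinRestriction.exists_mem_range_absGaloisRestrict_fixedField_iff`).
-/

noncomputable section

set_option linter.dupNamespace false -- project-wide option (lakefile weak.linter.dupNamespace); `Summit.Langlands.Langlands` is the mandated namespace

open scoped NumberField
open IsDedekindDomain Field Filter
open Literature.NumberTheory.Automorphic Literature.NumberTheory.GaloisRepresentations

namespace Summit.Langlands.Langlands.Theorems.EssSelfDualIrreducibleCM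

/-- **The quadratic extension cut out by an open subgroup of index `2` and its Frobenius
dictionary.**  Let `K` be a number field and `H ≤ Γ_K` an open subgroup of index `2`.  Then there is a
number field `L ⊇ K` with `[L : K] = 2` (namely `L = K̄^H`, so that `Gal(K̄/L) = H`) such that for
all but finitely many finite places `v` of `K` (those unramified in `L`), every arithmetic Frobenius
`Φ ∈ Γ_K` at every prime of `\bar ℤ_K` above `v` satisfies:
`Φ ∈ H` iff some place `w ∣ v` of `L` has residue degree `f(w|v) = 1` (`Φ ∈ Gal(K̄/L)` forces both
places above `v` to have degree `1`, `exists_places_split_of_mem_range`; `Φ ∉ Gal(K̄/L)` forces a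
single place of degree `2`, `exists_place_inert_of_not_mem_range`).  Neukirch, *Algebraic Number
Theory*, I (9.3)–(9.5); Cassels–Fröhlich, Ch. VII §4.2. [folklore] -/
theorem exists_quadratic_frob_mem_iff (K : Type) [Field K] [NumberField K]
    (H : Subgroup (absoluteGaloisGroup K)) (hHo : IsOpen (H : Set (absoluteGaloisGroup K)))
    (hH2 : H.index = 2) :
    ∃ (L : Type) (_ : Field L) (_ : NumberField L) (_ : Algebra K L), Module.finrank K L = 2 ∧
      ∀ᶠ v : HeightOneSpectrum (𝓞 K) in cofinite, ∀ 𝔓 ∈ v.primesAbove,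
        ∀ Φ : absoluteGaloisGroup K, IsArithFrobAt (𝓞 K) Φ 𝔓 →
          (Φ ∈ H ↔ ∃ w : HeightOneSpectrum (𝓞 L), w.asIdeal.under (𝓞 K) = v.asIdeal ∧
            w.asIdeal.inertiaDeg (𝓞 K) = 1) := by
  classical
  -- the fixed field `L = K̄^H`, a quadratic (hence Galois) number field over `K`
  set L : IntermediateField K (AlgebraicClosure K) := IntermediateField.fixedField H with hLdef
  haveI hfd : FiniteDimensional K L := finiteDimensional_fixedField_of_isOpen H hHo
  have h2 : Module.finrank K L = 2 := (finrank_fixedField_of_isOpen H hHo).trans hH2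
  haveI : NumberField L := NumberField.of_module_finite K L
  haveI : Algebra.IsQuadraticExtension K L := ⟨h2⟩
  haveI : IsGalois K L := inferInstance
  have hprime : (Module.finrank K L).Prime := by rw [h2]; exact Nat.prime_two
  haveI hHn : H.Normal := Subgroup.normal_of_index_eq_two hH2
  -- `Gal(K̄/L) = H` inside `Γ_K`
  set r := absGaloisRestrict K L with hr
  have hrange : ∀ γ, γ ∈ r.range ↔ γ ∈ H := by
    obtain ⟨g, hg⟩ := exists_mem_range_absGaloisRestrict_fixedField_iff H hHo
    intro γ
    rw [hr, hLdef, hg γ]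
    constructor
    · intro h
      have := hHn.conj_mem _ h g
      rwa [← mul_assoc, ← mul_assoc, mul_inv_cancel, one_mul, mul_assoc, mul_inv_cancel, mul_one] at this
    · intro h
      have := hHn.conj_mem _ h g⁻¹
      rwa [inv_inv] at this
  have hrangeH : r.range = H := Subgroup.ext hrange
  have hHi : r.range.index = Module.finrank K L := by rw [hrangeH, hH2, h2]
  have hrn : r.range.Normal := by rw [hrangeH]; exact hHn
  -- the rank-one representation with kernel `H`, unramified almost everywhere
  let θ₀ : absoluteGaloisGroup K →* ℂˣ := signCharOfIndexTwo H hH2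
  have hθ₀ker : (θ₀.ker : Set (absoluteGaloisGroup K)) = H := by
    rw [ker_signCharOfIndexTwo]
  have hθ₀cont : Continuous θ₀ :=
    MonoidHom.continuous_of_isOpen_ker θ₀ (by rw [hθ₀ker]; exact hHo)
  let θ : absoluteGaloisGroup K →ₜ* ℂˣ := ⟨θ₀, hθ₀cont⟩
  let ψ : FramedGaloisRep K ℂ 1 :=
    ContinuousMonoidHom.comp
      (FramedRep.unitsContinuousMulEquivOfUnique (Fin 1) ℂ : ℂˣ →ₜ* GL (Fin 1) ℂ) θ
  have hψ : ∀ g (i j : Fin 1),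
      ((ψ g : GL (Fin 1) ℂ) : Matrix (Fin 1) (Fin 1) ℂ) i j = (θ₀ g : ℂ) := fun g i j => rfl
  have hψ1 : ∀ g, ψ g = 1 ↔ g ∈ H := by
    intro g
    constructor
    · intro h
      by_contra hg
      have h1 := congr_fun (congr_fun (congrArg (fun x : GL (Fin 1) ℂ => (x : Matrix (Fin 1) (Fin 1) ℂ)) h) 0) 0
      rw [hψ, show θ₀ g = -1 from signCharOfIndexTwo_apply_of_not_mem hH2 hg,
        Matrix.GeneralLinearGroup.coe_one, Matrix.one_apply_eq, Units.val_neg, Units.val_one] at h1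
      norm_num at h1
    · intro hg
      ext i j
      rw [hψ, show θ₀ g = 1 from signCharOfIndexTwo_apply_of_mem hH2 hg, Units.val_one,
        Matrix.GeneralLinearGroup.coe_one, Subsingleton.elim i j, Matrix.one_apply_eq]
  have hker : IsOpen (ψ.toMonoidHom.ker : Set (absoluteGaloisGroup K)) := by
    have : (ψ.toMonoidHom.ker : Set (absoluteGaloisGroup K)) = H := by
      ext g
      exact hψ1 g
    rw [this]
    exact hHo
  have hunrψ : ∀ᶠ v in cofinite, ψ.IsUnramifiedAt v :=
    ψ.eventually_isUnramifiedAt_of_isOpen_ker hker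
  have hunrL : ∀ᶠ v : HeightOneSpectrum (𝓞 K) in cofinite, Algebra.IsUnramifiedIn (𝓞 L) v.asIdeal := by
    rw [eventually_cofinite]
    exact finite_setOf_not_isUnramifiedIn K L
  refine ⟨L, inferInstance, inferInstance, inferInstance, h2, ?_⟩
  filter_upwards [hunrψ, hunrL] with v hψv hvL
  intro 𝔓 h𝔓 Φ hΦ
  constructor
  · -- split: every place above `v` has residue degree `1`
    intro hΦH
    have hΦr : Φ ∈ r.range := (hrange Φ).mpr hΦH
    obtain ⟨c, hc⟩ : ∃ c, c ∉ r.range := by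
      by_contra! hall
      have : r.range = ⊤ := eq_top_iff.mpr fun g _ => hall g
      rw [this, Subgroup.index_top, h2] at hHi
      exact absurd hHi (by norm_num)
    obtain ⟨P, 𝔔, τ, hP, hf1, -, -⟩ :=
      exists_places_split_of_mem_range (F := K) (M := L) hprime hrn hHi hc hvL h𝔓 hΦ hΦr
    exact ⟨P 0, congrArg HeightOneSpectrum.asIdeal (hP 0).1, hf1 _ (hP 0).1⟩
  · -- inert: one place above `v`, of residue degree `2`
    rintro ⟨w', hw', hf'⟩
    by_contra hΦH
    have hΦr : Φ ∉ r.range := fun h => hΦH ((hrange Φ).mp h)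
    have hI : 𝔓.inertia (absoluteGaloisGroup K) ≤ r.range := fun g hg =>
      (hrange g).mpr ((hψ1 g).mp (hψv 𝔓 h𝔓 g hg))
    obtain ⟨w, -, -, -, huniq, hfw, -⟩ :=
      exists_place_inert_of_not_mem_range (F := K) (M := L) hprime hrn hHi hvL h𝔓 hI hΦ hΦr
    have hw'v : w'.under (𝓞 K) = v := HeightOneSpectrum.ext hw'
    have := huniq w' hw'v
    subst this
    rw [hfw, h2] at hf'
    exact absurd hf' (by norm_num)

end Summit.Langlands.Langlands.Theorems.EssSelfDualIrreducibleCM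

end
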